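import Summits.Ventures.PercRepro.C041TriDomExcessWeightedFair
import Summits.Ventures.PercRepro.C041TriDomMonotoneInjection

/-!
# ROW C-041 — THE MIXTURE PRINCIPLE: FORCED-SET POSITIVITY AT `p = ½` GIVES POSITIVITY AT EVERY `p ≥ ½`
(p6, gen 44; P6-TWOEXIT-LEAN.md §53 ADDENDUM 14)

For a single edge `f` of probability `p ≥ ½` the product measure is the MIXTURE of the point mass «`f` red» (weight
`2p − 1`) and the fair coin at `f` (weight `2 − 2p`): for every function `g` of the colourings,
`E_w[g] = (2p − 1) · 2 E_{w[f:=½]}[g · 1_{f red}] + (2 − 2p) · E_{w[f:=½]}[g]` (`sum_cwt_mixture`, a two-case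
identity per colouring).  Iterating over the edges: **THE MIXTURE PRINCIPLE** (`sum_cwt_nonneg_of_forced`) — if
the fair sum of `g` over every principal up-set «`S` red» is non-negative, then `E_w[g] ≥ 0` for all edge
probabilities `w e ∈ [½, 1]` (induction on the set of edges carrying their own probability; the forced-set
condition is stable under forcing one more edge).  Consequences: THEOREM (TWO-MARK DOMINATION) holds at every edge
probability `≥ ½` on every up-set `V` — `P_w(V ∧ x ~_B z) ≤ P_w(V ∧ x ~_R z)` (`weighted_blue_le_red`) — and the
up-set form of CONJECTURE (STOCHASTIC DOMINATION) implies its weighted form `P_w(V ∧ A) ≤ P_w(V ∧ (⊤,⊥))` for all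
`w e ∈ [½, 1]` and all up-sets `V` (`cycDomination_weighted`; the converse is the case `w = ½`,
`cycDomination_of_weighted`), the form (iii) of §53 ADDENDUM 10 cont. 1.
-/

namespace PercRepro

namespace ZoneZ

namespace MultiExit

open ZoneData Finset

variable {V₁ E₁ U₁ U₂ : Type} (Z₁ : ZoneData V₁ E₁ U₁ U₂)

variable [Fintype E₁] [DecidableEq E₁]

/-! ## The one-edge mixture identity for an arbitrary function -/

omit Z₁ in
/-- **THE ONE-EDGE MIXTURE IDENTITY** for an arbitrary function of the colourings. -/
theorem sum_cwt_mixture (w : E₁ → ℚ) (f : E₁) (g : (E₁ → Bool) → ℚ) :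
    ∑ ω : E₁ → Bool, cwt w ω * g ω =
      (2 * w f - 1) * (2 * ∑ ω : E₁ → Bool, cwt (Function.update w f (1 / 2)) ω * (if ω f = true then g ω else 0))
        + (2 - 2 * w f) * ∑ ω : E₁ → Bool, cwt (Function.update w f (1 / 2)) ω * g ω := by
  rw [Finset.mul_sum, Finset.mul_sum, Finset.mul_sum, ← Finset.sum_add_distrib]
  refine Finset.sum_congr rfl fun ω _ => ?_
  rw [cwt_eq f w ω, cwt_eq f (Function.update w f (1 / 2)) ω, cwt'_update, Function.update_self]
  by_cases h : ω f = true
  · rw [if_pos h]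
    simp only [h, wt, if_true]
    ring
  · rw [if_neg h]
    simp only [h, wt, Bool.false_eq_true, if_false]
    ring

/-! ## The mixture principle -/

/-- The probabilities `w` on the edges of `X`, fair elsewhere. -/
def wOn (w : E₁ → ℚ) (X : Finset E₁) : E₁ → ℚ := fun e => if e ∈ X then w e else 1 / 2

omit Z₁ [Fintype E₁] in
/-- `wOn` on an inserted edge is an update. -/
theorem wOn_insert (w : E₁ → ℚ) (X : Finset E₁) (f : E₁) :
    wOn w (insert f X) = Function.update (wOn w X) f (w f) := by
  funext e
  by_cases he : e = f
  · subst he; simp [wOn]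
  · simp [wOn, he]

omit Z₁ [Fintype E₁] in
/-- Updating an edge off `X` back to fair returns `wOn w X`. -/
theorem wOn_update_half (w : E₁ → ℚ) (X : Finset E₁) (f : E₁) (hf : f ∉ X) :
    Function.update (wOn w X) f (1 / 2) = wOn w X := by
  funext e
  by_cases he : e = f
  · subst he; simp [wOn, hf]
  · simp [Function.update_of_ne he]

omit Z₁ in
/-- The forced-set condition is stable under forcing one more edge. -/
theorem forced_condition_insert (g : (E₁ → Bool) → ℚ)
    (hg : ∀ S : Finset E₁, 0 ≤ ∑ ω : E₁ → Bool, if (∀ e ∈ S, ω e = true) then g ω else 0) (f : E₁)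
    (S : Finset E₁) :
    0 ≤ ∑ ω : E₁ → Bool, if (∀ e ∈ S, ω e = true) then (if ω f = true then g ω else 0) else 0 := by
  have h := hg (insert f S)
  refine le_of_le_of_eq h (Finset.sum_congr rfl fun ω _ => ?_)
  by_cases hS : ∀ e ∈ S, ω e = true
  · by_cases hf : ω f = true
    · rw [if_pos hS, if_pos hf, if_pos]
      intro e he
      rcases Finset.mem_insert.mp he with rfl | he'
      · exact hf
      · exact hS e he'
    · rw [if_pos hS, if_neg hf, if_neg]
      intro h'
      exact hf (h' f (Finset.mem_insert_self f S))
  · rw [if_neg hS, if_neg]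
    intro h'
    exact hS fun e he => h' e (Finset.mem_insert_of_mem he)

omit Z₁ in
/-- **THE MIXTURE PRINCIPLE**: if the fair sum of `g` over every principal up-set «`S` red» is non-negative, the
weighted sum is non-negative for all edge probabilities in `[½, 1]`. -/
theorem sum_cwt_nonneg_of_forced (g : (E₁ → Bool) → ℚ)
    (hg : ∀ S : Finset E₁, 0 ≤ ∑ ω : E₁ → Bool, if (∀ e ∈ S, ω e = true) then g ω else 0)
    (w : E₁ → ℚ) (hw : ∀ e, 1 / 2 ≤ w e ∧ w e ≤ 1) : 0 ≤ ∑ ω : E₁ → Bool, cwt w ω * g ω := by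
  suffices H : ∀ X : Finset E₁, ∀ g : (E₁ → Bool) → ℚ,
      (∀ S : Finset E₁, 0 ≤ ∑ ω : E₁ → Bool, if (∀ e ∈ S, ω e = true) then g ω else 0) →
      0 ≤ ∑ ω : E₁ → Bool, cwt (wOn w X) ω * g ω by
    have h := H Finset.univ g hg
    have hw' : wOn w Finset.univ = w := by funext e; simp [wOn]
    rwa [hw'] at h
  intro X
  induction X using Finset.induction_on with
  | empty =>
    intro g hg
    have h0 : wOn w ∅ = fun _ => (1 / 2 : ℚ) := by funext e; simp [wOn]
    rw [h0]
    simp only [cwt_half, ← Finset.mul_sum]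
    refine mul_nonneg (by positivity) ?_
    have := hg ∅
    simpa using this
  | @insert f X hf ih =>
    intro g hg
    rw [wOn_insert, sum_cwt_mixture (Function.update (wOn w X) f (w f)) f g, Function.update_idem,
      wOn_update_half w X f hf, Function.update_self]
    have h1 := ih (fun ω => if ω f = true then g ω else 0) (forced_condition_insert g hg f)
    have h2 := ih g hg
    have hc1 : 0 ≤ 2 * w f - 1 := by linarith [(hw f).1]
    have hc2 : 0 ≤ 2 - 2 * w f := by linarith [(hw f).2]
    have h1' : (0 : ℚ) ≤ 2 * ∑ ω : E₁ → Bool, cwt (wOn w X) ω * (if ω f = true then g ω else 0) :=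
      mul_nonneg (by norm_num) h1
    exact add_nonneg (mul_nonneg hc1 h1') (mul_nonneg hc2 h2)

/-! ## The two-mark domination at every edge probability -/

variable (x z : V₁)

omit [Fintype E₁] [DecidableEq E₁] in
/-- The intersection of an up-set with a principal up-set is an up-set. -/
theorem upSet_inter_forced {V : (E₁ → Bool) → Prop} (hV : UpSet V) (S : Finset E₁) :
    UpSet fun ω : E₁ → Bool => V ω ∧ ∀ e ∈ S, ω e = true := by
  intro ω ω' h hle
  exact ⟨hV ω ω' h.1 hle, fun e he => hle e (h.2 e he)⟩

open Classical in
/-- **THEOREM (TWO-MARK DOMINATION AT EVERY EDGE PROBABILITY ≥ ½)**: on every up-set `V`,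
`P_w(V ∧ x ~_B z) ≤ P_w(V ∧ x ~_R z)` for all `w e ∈ [½, 1]`. -/
theorem weighted_blue_le_red {V : (E₁ → Bool) → Prop} (hV : UpSet V) (w : E₁ → ℚ)
    (hw : ∀ e, 1 / 2 ≤ w e ∧ w e ≤ 1) :
    ∑ ω : E₁ → Bool, cwt w ω * (if V ω ∧ Z₁.Mg x z ω then 1 else 0) ≤
      ∑ ω : E₁ → Bool, cwt w ω * (if V ω ∧ Z₁.Rd x z ω then 1 else 0) := by
  have h := sum_cwt_nonneg_of_forced
    (fun ω => (if V ω ∧ Z₁.Rd x z ω then 1 else 0) - (if V ω ∧ Z₁.Mg x z ω then 1 else 0)) (fun S => by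
      have hc := count_blue_le_count_red Z₁ x z (upSet_inter_forced hV S)
      have hR : ∑ ω : E₁ → Bool, (if (∀ e ∈ S, ω e = true) then (if V ω ∧ Z₁.Rd x z ω then (1 : ℚ) else 0) else 0) =
          ((univ.filter fun ω : E₁ → Bool => (V ω ∧ ∀ e ∈ S, ω e = true) ∧ Z₁.Rd x z ω).card : ℚ) := by
        rw [Finset.card_filter]
        push_cast
        refine Finset.sum_congr rfl fun ω _ => ?_
        by_cases hS : ∀ e ∈ S, ω e = true <;> by_cases hV' : V ω <;> by_cases hRd : Z₁.Rd x z ω <;>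
          simp [hS, hV', hRd]
      have hB : ∑ ω : E₁ → Bool, (if (∀ e ∈ S, ω e = true) then (if V ω ∧ Z₁.Mg x z ω then (1 : ℚ) else 0) else 0) =
          ((univ.filter fun ω : E₁ → Bool => (V ω ∧ ∀ e ∈ S, ω e = true) ∧ Z₁.Mg x z ω).card : ℚ) := by
        rw [Finset.card_filter]
        push_cast
        refine Finset.sum_congr rfl fun ω _ => ?_
        by_cases hS : ∀ e ∈ S, ω e = true <;> by_cases hV' : V ω <;> by_cases hMg : Z₁.Mg x z ω <;>
          simp [hS, hV', hMg]
      have hsplit : ∑ ω : E₁ → Bool, (if (∀ e ∈ S, ω e = true) then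
          ((if V ω ∧ Z₁.Rd x z ω then (1 : ℚ) else 0) - (if V ω ∧ Z₁.Mg x z ω then 1 else 0)) else 0) =
          ∑ ω : E₁ → Bool, (if (∀ e ∈ S, ω e = true) then (if V ω ∧ Z₁.Rd x z ω then (1 : ℚ) else 0) else 0)
            - ∑ ω : E₁ → Bool, (if (∀ e ∈ S, ω e = true) then (if V ω ∧ Z₁.Mg x z ω then (1 : ℚ) else 0) else 0) := by
        rw [← Finset.sum_sub_distrib]
        refine Finset.sum_congr rfl fun ω _ => ?_
        by_cases hS : ∀ e ∈ S, ω e = true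
        · simp only [if_pos hS]
        · simp only [if_neg hS, sub_zero]
      rw [hsplit, hR, hB, sub_nonneg]
      have hc2 := (Nat.cast_le (α := ℚ)).mpr hc
      convert hc2 <;> rfl) w hw
  simp only [mul_sub, Finset.sum_sub_distrib, sub_nonneg] at h
  exact h

/-! ## CONJECTURE (STOCHASTIC DOMINATION): the weighted form -/

variable (y : V₁)

open Classical in
/-- The up-set form of CONJECTURE (STOCHASTIC DOMINATION) gives its weighted form: for all `w e ∈ [½, 1]` and every
up-set `V`, `P_w(V ∧ A) ≤ P_w(V ∧ (⊤, ⊥))`. -/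
theorem cycDomination_weighted (h : CycDomination Z₁ x y z) {V : (E₁ → Bool) → Prop} (hV : UpSet V)
    (w : E₁ → ℚ) (hw : ∀ e, 1 / 2 ≤ w e ∧ w e ≤ 1) :
    ∑ ω : E₁ → Bool, cwt w ω * (if V ω ∧ CycCrossed Z₁ x y z ω then 1 else 0) ≤
      ∑ ω : E₁ → Bool, cwt w ω * (if V ω ∧ TopBot Z₁ x y z ω then 1 else 0) := by
  have h' := sum_cwt_nonneg_of_forced
    (fun ω => (if V ω ∧ TopBot Z₁ x y z ω then 1 else 0) - (if V ω ∧ CycCrossed Z₁ x y z ω then 1 else 0))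
    (fun S => by
      have hc := h _ (upSet_inter_forced hV S)
      have hR : ∑ ω : E₁ → Bool, (if (∀ e ∈ S, ω e = true) then
            (if V ω ∧ TopBot Z₁ x y z ω then (1 : ℚ) else 0) else 0) =
          ((univ.filter fun ω : E₁ → Bool => (V ω ∧ ∀ e ∈ S, ω e = true) ∧ TopBot Z₁ x y z ω).card : ℚ) := by
        rw [Finset.card_filter]
        push_cast
        refine Finset.sum_congr rfl fun ω _ => ?_
        by_cases hS : ∀ e ∈ S, ω e = true <;> by_cases hV' : V ω <;> by_cases hT : TopBot Z₁ x y z ω <;>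
          simp [hS, hV', hT]
      have hB : ∑ ω : E₁ → Bool, (if (∀ e ∈ S, ω e = true) then
            (if V ω ∧ CycCrossed Z₁ x y z ω then (1 : ℚ) else 0) else 0) =
          ((univ.filter fun ω : E₁ → Bool => (V ω ∧ ∀ e ∈ S, ω e = true) ∧ CycCrossed Z₁ x y z ω).card : ℚ) := by
        rw [Finset.card_filter]
        push_cast
        refine Finset.sum_congr rfl fun ω _ => ?_
        by_cases hS : ∀ e ∈ S, ω e = true <;> by_cases hV' : V ω <;> by_cases hA : CycCrossed Z₁ x y z ω <;>
          simp [hS, hV', hA]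
      have hsplit : ∑ ω : E₁ → Bool, (if (∀ e ∈ S, ω e = true) then
          ((if V ω ∧ TopBot Z₁ x y z ω then (1 : ℚ) else 0)
            - (if V ω ∧ CycCrossed Z₁ x y z ω then 1 else 0)) else 0) =
          ∑ ω : E₁ → Bool, (if (∀ e ∈ S, ω e = true) then (if V ω ∧ TopBot Z₁ x y z ω then (1 : ℚ) else 0) else 0)
            - ∑ ω : E₁ → Bool, (if (∀ e ∈ S, ω e = true) then
                (if V ω ∧ CycCrossed Z₁ x y z ω then (1 : ℚ) else 0) else 0) := by
        rw [← Finset.sum_sub_distrib]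
        refine Finset.sum_congr rfl fun ω _ => ?_
        by_cases hS : ∀ e ∈ S, ω e = true
        · simp only [if_pos hS]
        · simp only [if_neg hS, sub_zero]
      rw [hsplit, hR, hB, sub_nonneg]
      have hc2 := (Nat.cast_le (α := ℚ)).mpr hc
      convert hc2 <;> rfl) w hw
  simp only [mul_sub, Finset.sum_sub_distrib, sub_nonneg] at h'
  exact h'

open Classical in
/-- The weighted form at `w = ½` is the up-set form: the two forms of the conjecture are equivalent. -/
theorem cycDomination_of_weighted
    (h : ∀ V : (E₁ → Bool) → Prop, UpSet V → ∀ w : E₁ → ℚ, (∀ e, 1 / 2 ≤ w e ∧ w e ≤ 1) →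
      ∑ ω : E₁ → Bool, cwt w ω * (if V ω ∧ CycCrossed Z₁ x y z ω then 1 else 0) ≤
        ∑ ω : E₁ → Bool, cwt w ω * (if V ω ∧ TopBot Z₁ x y z ω then 1 else 0)) :
    CycDomination Z₁ x y z := by
  intro V hV
  have h' := h V hV (fun _ => (1 / 2 : ℚ)) (fun _ => by norm_num)
  simp only [cwt_half, ← Finset.mul_sum] at h'
  have hp : (0 : ℚ) < (1 / 2) ^ Fintype.card E₁ := by positivity
  have h'' := le_of_mul_le_mul_left h' hp
  rw [Finset.card_filter, Finset.card_filter]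
  have hA : ∑ ω : E₁ → Bool, (if V ω ∧ CycCrossed Z₁ x y z ω then (1 : ℚ) else 0) =
      ((∑ ω : E₁ → Bool, if V ω ∧ CycCrossed Z₁ x y z ω then 1 else 0 : ℕ) : ℚ) := by
    push_cast; rfl
  have hT : ∑ ω : E₁ → Bool, (if V ω ∧ TopBot Z₁ x y z ω then (1 : ℚ) else 0) =
      ((∑ ω : E₁ → Bool, if V ω ∧ TopBot Z₁ x y z ω then 1 else 0 : ℕ) : ℚ) := by
    push_cast; rfl
  rw [hA, hT] at h''
  exact_mod_cast h''

end MultiExit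

end ZoneZ

end PercRepro
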